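import Summits.QuantumFields.YangMills.Theorems.SmallCircleAnchorAnchorGapActivityBound
import Summits.QuantumFields.YangMills.Theorems.SmallCircleAnchorAnchorGapGaussianMomentBound
import HarnessLib

/-!
# Crux `AnchorGap` (stmt-QuantumFields-11141), line `registered` — GBND's analytic input for GREP's
# OWN polynomial-growth class: `|E(cov X σ_s(t))(D^s Π_{b∈X} G_b)| ≤ M · Π_{ℓ∈lines(s)} (½ Σ_{x,y∈ℓ} |C_xy|)`
# when `‖DⁿG_b(φ)‖ ≤ K_b(n)·(1 + Σᵢφᵢ²)^{m_b(n)}`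

Continuation of ✓`SmallCircleAnchorAnchorGapActivityBound.lean` (bounded tables, p795527) and
✓`SmallCircleAnchorAnchorGapGaussianMomentBound.lean` (σ-uniform moments).  GREP
(`stub_gaussianBBFPolymerRep`) assumes `∀ b n, ∃ K m, ‖DⁿG_b(φ)‖ ≤ K(1 + Σᵢφᵢ²)^m`; choosing the
constants as tables `K_b(n)`, `m_b(n)`:

* §1 `table_update₂_at`, `abs_foldl_dop_prod_le_at` — the POINTWISE-table edition of
  ✓`ActBound.abs_foldl_dop_prod_le` (the table only at the point `φ` where the bound is read);
  `abs_foldl_dop_prod_le_polyGrowth` — `|D^L Π_{b∈X} G_b (φ)| ≤ Π_ℓ(½Σ|C_xy|) · Π_b K_b(deg_L b) ·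
  (1 + Σᵢφᵢ²)^{Σ_b m_b(deg_L b)}`;
* §2 `abs_quadForm_le_entries`, `quadForm_cov_le` — GREP's interpolated covariance has form
  `≤ (1 + Σ_{i,j}|C_ij|)·Σφᵢ²` whenever `|σ| ≤ 1`; `abs_eval_decPt_le_one` — decoupled points have
  entries in `[−1, 1]` (lit ✓`Script.eval_decPt_mk_y`, ✓`decPt_mk_of_notMem`,
  ✓`decPt_mk_of_mem_of_notMem`);
* §3 `abs_gaussExpect_le_of_abs_le_polyWeight` — `|H| ≤ c·(1+Σφᵢ²)^N ⇒ |E_M(H)| ≤ c·E_M[(1+Σφᵢ²)^N]`;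
  ★`abs_gaussExpect_foldl_dop_prod_le_polyGrowth` — GBND's hypothesis `h` for GREP's data in GREP's
  own class: `M := (Π_b K_b(deg b))·N!·(4Λ)^N·e^{1/(4Λ)}·√2^{|ι|}` with `N = Σ_b m_b(deg_s b)`,
  `Λ = 1 + Σ|C_ij|`, `y ℓ = ½Σ_{x,y∈ℓ}|C_xy|` — depending on the script only through the degrees.

[folklore]; no definition, no named fact; GREP's `E`, `cov`, `Dop` texts INLINED.
-/

set_option autoImplicit false

namespace Summit.QuantumFields.YangMills.Theorems.AnchorGap.ActBound

open Finset MeasureTheory MvPolynomial Literature.Probability.LatticeModels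
  Literature.Probability.LatticeModels.BattleFederbush Literature.MeasureTheory.Integral
open scoped ContDiff Matrix

variable {ι : Type} [Fintype ι] [DecidableEq ι] {β : Type} [DecidableEq β]

/-! ### §1 Pointwise tables and the polynomial-growth class -/

/-- Table shift at a point (pointwise edition of ✓`table_update₂`). [folklore] -/
theorem table_update₂_at (blk : ι → β) {F : β → (ι → ℝ) → ℝ} (hF : ∀ b, ContDiff ℝ (⊤ : ℕ∞) (F b))
    (φ : ι → ℝ) {S : β → ℕ → ℝ} (hS : ∀ (b : β) (n : ℕ), ‖iteratedFDeriv ℝ n (F b) φ‖ ≤ S b n)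
    (ℓ : Sym2 β) (x y : ι) (hc : s(blk x, blk y) = ℓ ∧ blk x ≠ blk y) :
    ∀ (b : β) (n : ℕ),
      ‖iteratedFDeriv ℝ n (fun φ : ι → ℝ => if b = blk x then fderiv ℝ (F b) φ (Pi.single x 1)
        else if b = blk y then fderiv ℝ (F b) φ (Pi.single y 1) else F b φ) φ‖
      ≤ S b (n + if b ∈ ℓ then 1 else 0) := by
  intro b n
  have hmem : b ∈ ℓ ↔ b = blk x ∨ b = blk y := by rw [← hc.1]; exact Sym2.mem_iff
  by_cases hbx : b = blk x
  · rw [if_pos (hmem.2 (Or.inl hbx))]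
    subst hbx
    simp only [if_true]
    calc ‖iteratedFDeriv ℝ n (fun φ => fderiv ℝ (F (blk x)) φ (Pi.single x 1)) φ‖
        ≤ ‖(Pi.single x (1 : ℝ) : ι → ℝ)‖ * ‖iteratedFDeriv ℝ (n + 1) (F (blk x)) φ‖ :=
          PolyGrowth.norm_iteratedFDeriv_partial_le (hF _) _ n φ
      _ ≤ 1 * S (blk x) (n + 1) :=
          mul_le_mul (PolyGrowth.norm_single_le_one x) (hS _ _) (norm_nonneg _) zero_le_one
      _ = S (blk x) (n + 1) := one_mul _
  · by_cases hby : b = blk y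
    · rw [if_pos (hmem.2 (Or.inr hby))]
      subst hby
      simp only [if_neg hbx, if_true]
      calc ‖iteratedFDeriv ℝ n (fun φ => fderiv ℝ (F (blk y)) φ (Pi.single y 1)) φ‖
          ≤ ‖(Pi.single y (1 : ℝ) : ι → ℝ)‖ * ‖iteratedFDeriv ℝ (n + 1) (F (blk y)) φ‖ :=
            PolyGrowth.norm_iteratedFDeriv_partial_le (hF _) _ n φ
        _ ≤ 1 * S (blk y) (n + 1) :=
            mul_le_mul (PolyGrowth.norm_single_le_one y) (hS _ _) (norm_nonneg _) zero_le_one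
        _ = S (blk y) (n + 1) := one_mul _
    · simp only [if_neg hbx, if_neg hby]
      rw [if_neg (fun h => (hmem.1 h).elim hbx hby), add_zero]
      exact hS b n

/-- **Pointwise-table edition of the per-script bound**: the table is only required at the point
`φ` where the bound is read. [folklore] -/
theorem abs_foldl_dop_prod_le_at (blk : ι → β) (C : Matrix ι ι ℝ) (X : Finset β) (φ : ι → ℝ) :
    ∀ (L : List (Sym2 β)), (∀ ℓ ∈ L, ∀ a ∈ ℓ, a ∈ X) →
      ∀ (F : β → (ι → ℝ) → ℝ), (∀ b, ContDiff ℝ (⊤ : ℕ∞) (F b)) →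
        (∀ (b : β) (φ ψ : ι → ℝ), (∀ i : ι, blk i = b → φ i = ψ i) → F b φ = F b ψ) →
        ∀ (S : β → ℕ → ℝ), (∀ (b : β) (n : ℕ), ‖iteratedFDeriv ℝ n (F b) φ‖ ≤ S b n) →
          |(L.foldl (fun (H : (ι → ℝ) → ℝ) (ℓ : Sym2 β) => fun φ : ι → ℝ =>
              (1 / 2 : ℝ) * ∑ x : ι, ∑ y : ι, if s(blk x, blk y) = ℓ ∧ blk x ≠ blk y then
                C x y * iteratedFDeriv ℝ 2 H φ ![Pi.single x 1, Pi.single y 1] else 0)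
              (fun φ : ι → ℝ => ∏ b ∈ X, F b φ)) φ|
          ≤ (L.map fun ℓ => (1 / 2 : ℝ) * ∑ x : ι, ∑ y : ι,
                if s(blk x, blk y) = ℓ ∧ blk x ≠ blk y then |C x y| else 0).prod
            * ∏ b ∈ X, S b ((L.map fun ℓ => if b ∈ ℓ then 1 else 0).sum) := by
  classical
  intro L
  induction L with
  | nil =>
    intro _ F _ _ S hS
    simp only [List.foldl_nil, List.map_nil, List.prod_nil, List.sum_nil, one_mul, Finset.abs_prod]
    exact Finset.prod_le_prod (fun b _ => abs_nonneg _) fun b _ => by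
      rw [PolyGrowth.abs_le_of_norm_iteratedFDeriv_zero]; exact hS b 0
  | cons ℓ L ih =>
    intro hL F hF hFl S hS
    have hℓ : ∀ a ∈ ℓ, a ∈ X := hL ℓ (by simp)
    have hL' : ∀ ℓ' ∈ L, ∀ a ∈ ℓ', a ∈ X := fun ℓ' h => hL ℓ' (List.mem_cons_of_mem _ h)
    simp only [List.foldl_cons, List.map_cons, List.prod_cons, List.sum_cons]
    have hstep : (fun φ : ι → ℝ => (1 / 2 : ℝ) * ∑ x : ι, ∑ y : ι,
        if s(blk x, blk y) = ℓ ∧ blk x ≠ blk y then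
          C x y * iteratedFDeriv ℝ 2 (fun φ : ι → ℝ => ∏ b ∈ X, F b φ) φ
            ![Pi.single x 1, Pi.single y 1] else 0)
        = fun φ => ∑ p ∈ (Finset.univ : Finset (ι × ι)),
          ((1 / 2 : ℝ) * if s(blk p.1, blk p.2) = ℓ ∧ blk p.1 ≠ blk p.2 then C p.1 p.2 else 0)
          * ∏ b ∈ X, (if b = blk p.1 then fderiv ℝ (F b) φ (Pi.single p.1 1)
              else if b = blk p.2 then fderiv ℝ (F b) φ (Pi.single p.2 1) else F b φ) := by
      funext φ
      rw [dop_prod_eq_sum blk C X ℓ hℓ hF hFl φ, Fintype.sum_prod_type]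
    rw [hstep, foldl_dop_lincomb blk C (Finset.univ : Finset (ι × ι)) L
      (fun p : ι × ι => (1 / 2 : ℝ) * if s(blk p.1, blk p.2) = ℓ ∧ blk p.1 ≠ blk p.2
        then C p.1 p.2 else 0)
      (fun (p : ι × ι) (φ : ι → ℝ) => ∏ b ∈ X, (if b = blk p.1 then fderiv ℝ (F b) φ (Pi.single p.1 1)
        else if b = blk p.2 then fderiv ℝ (F b) φ (Pi.single p.2 1) else F b φ))
      (fun p => contDiff_prod fun b _ => contDiff_update₂ blk hF p.1 p.2 b)]
    refine (Finset.abs_sum_le_sum_abs _ _).trans ?_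
    have hterm : ∀ p : ι × ι,
        |((1 / 2 : ℝ) * if s(blk p.1, blk p.2) = ℓ ∧ blk p.1 ≠ blk p.2 then C p.1 p.2 else 0)
          * L.foldl (fun (H : (ι → ℝ) → ℝ) (ℓ : Sym2 β) => fun φ : ι → ℝ =>
              (1 / 2 : ℝ) * ∑ x : ι, ∑ y : ι, if s(blk x, blk y) = ℓ ∧ blk x ≠ blk y then
                C x y * iteratedFDeriv ℝ 2 H φ ![Pi.single x 1, Pi.single y 1] else 0)
            (fun φ => ∏ b ∈ X, (if b = blk p.1 then fderiv ℝ (F b) φ (Pi.single p.1 1)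
              else if b = blk p.2 then fderiv ℝ (F b) φ (Pi.single p.2 1) else F b φ)) φ|
        ≤ ((1 / 2 : ℝ) * if s(blk p.1, blk p.2) = ℓ ∧ blk p.1 ≠ blk p.2 then |C p.1 p.2| else 0)
          * ((L.map fun ℓ => (1 / 2 : ℝ) * ∑ x : ι, ∑ y : ι,
              if s(blk x, blk y) = ℓ ∧ blk x ≠ blk y then |C x y| else 0).prod
            * ∏ b ∈ X, S b ((if b ∈ ℓ then 1 else 0)
              + (L.map fun ℓ => if b ∈ ℓ then 1 else 0).sum)) := by
      intro p
      by_cases hc : s(blk p.1, blk p.2) = ℓ ∧ blk p.1 ≠ blk p.2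
      · rw [if_pos hc, if_pos hc, abs_mul, abs_mul, abs_of_pos (by norm_num : (0 : ℝ) < 1 / 2)]
        refine mul_le_mul_of_nonneg_left ?_ (by positivity)
        have h := ih hL' _ (fun b => contDiff_update₂ blk hF p.1 p.2 b)
          (local_update₂ blk hF hFl p.1 p.2) (fun b n => S b (n + if b ∈ ℓ then 1 else 0))
          (table_update₂_at blk hF φ hS ℓ p.1 p.2 hc)
        refine h.trans (le_of_eq ?_)
        congr 1
        exact Finset.prod_congr rfl fun b _ => by rw [add_comm]
      · rw [if_neg hc, if_neg hc]; simp
    refine (Finset.sum_le_sum fun p _ => hterm p).trans (le_of_eq ?_)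
    rw [← Finset.sum_mul, Fintype.sum_prod_type]
    simp only [Finset.mul_sum]
    ring

/-- **The per-script bound in GREP's polynomial-growth class** (pointwise in `φ`): with tables
`‖DⁿG_b(φ)‖ ≤ K_b(n)·(1+Σφᵢ²)^{m_b(n)}`,
`|D^L Π_{b∈X} G_b (φ)| ≤ Π_ℓ(½Σ|C_xy|) · Π_b K_b(deg_L b) · (1 + Σᵢφᵢ²)^{Σ_b m_b(deg_L b)}`.
[folklore] -/
theorem abs_foldl_dop_prod_le_polyGrowth (blk : ι → β) (C : Matrix ι ι ℝ) (X : Finset β)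
    (L : List (Sym2 β)) (hL : ∀ ℓ ∈ L, ∀ a ∈ ℓ, a ∈ X)
    (G : β → (ι → ℝ) → ℝ) (hG : ∀ b, ContDiff ℝ (⊤ : ℕ∞) (G b))
    (hGl : ∀ (b : β) (φ ψ : ι → ℝ), (∀ i : ι, blk i = b → φ i = ψ i) → G b φ = G b ψ)
    (K : β → ℕ → ℝ) (m : β → ℕ → ℕ)
    (hKm : ∀ (b : β) (n : ℕ) (φ : ι → ℝ),
      ‖iteratedFDeriv ℝ n (G b) φ‖ ≤ K b n * (1 + ∑ i, φ i ^ 2) ^ m b n) (φ : ι → ℝ) :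
    |(L.foldl (fun (H : (ι → ℝ) → ℝ) (ℓ : Sym2 β) => fun φ : ι → ℝ =>
        (1 / 2 : ℝ) * ∑ x : ι, ∑ y : ι, if s(blk x, blk y) = ℓ ∧ blk x ≠ blk y then
          C x y * iteratedFDeriv ℝ 2 H φ ![Pi.single x 1, Pi.single y 1] else 0)
        (fun φ : ι → ℝ => ∏ b ∈ X, G b φ)) φ|
      ≤ (L.map fun ℓ => (1 / 2 : ℝ) * ∑ x : ι, ∑ y : ι,
          if s(blk x, blk y) = ℓ ∧ blk x ≠ blk y then |C x y| else 0).prod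
        * ((∏ b ∈ X, K b ((L.map fun ℓ => if b ∈ ℓ then 1 else 0).sum))
          * (1 + ∑ i, φ i ^ 2) ^ ∑ b ∈ X, m b ((L.map fun ℓ => if b ∈ ℓ then 1 else 0).sum)) := by
  have h := abs_foldl_dop_prod_le_at blk C X φ L hL G hG hGl
    (fun b n => K b n * (1 + ∑ i, φ i ^ 2) ^ m b n) (fun b n => hKm b n φ)
  refine h.trans (le_of_eq ?_)
  rw [Finset.prod_mul_distrib, Finset.prod_pow_eq_pow_sum]

/-! ### §2 The interpolated covariance has a σ-uniform form bound -/

omit [DecidableEq ι] in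
/-- `|φᵀDφ| ≤ (Σ_{p,q}|D_pq|)·Σᵢφᵢ²`. [folklore] -/
theorem abs_quadForm_le_entries (D : Matrix ι ι ℝ) (φ : ι → ℝ) :
    |φ ⬝ᵥ (D *ᵥ φ)| ≤ (∑ p, ∑ q, |D p q|) * ∑ i, φ i ^ 2 := by
  have hs : ∀ j, φ j ^ 2 ≤ ∑ i, φ i ^ 2 := fun j =>
    Finset.single_le_sum (f := fun i => φ i ^ 2) (fun i _ => sq_nonneg _) (Finset.mem_univ j)
  have hprod : ∀ p q, |φ p| * |φ q| ≤ ∑ i, φ i ^ 2 := fun p q => by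
    have h2 : 2 * (|φ p| * |φ q|) ≤ φ p ^ 2 + φ q ^ 2 := by
      nlinarith [sq_nonneg (|φ p| - |φ q|), sq_abs (φ p), sq_abs (φ q)]
    nlinarith [hs p, hs q, abs_nonneg (φ p), abs_nonneg (φ q)]
  have hq : φ ⬝ᵥ (D *ᵥ φ) = ∑ p, ∑ q, D p q * (φ p * φ q) := by
    simp only [dotProduct, Matrix.mulVec, Finset.mul_sum]
    exact Finset.sum_congr rfl fun p _ => Finset.sum_congr rfl fun q _ => by ring
  rw [hq, Finset.sum_mul]
  refine (Finset.abs_sum_le_sum_abs _ _).trans (Finset.sum_le_sum fun p _ => ?_)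
  rw [Finset.sum_mul]
  refine (Finset.abs_sum_le_sum_abs _ _).trans (Finset.sum_le_sum fun q _ => ?_)
  rw [abs_mul, abs_mul]
  exact mul_le_mul_of_nonneg_left (hprod p q) (abs_nonneg _)

omit [DecidableEq ι] in
/-- **GREP's interpolated covariance has a σ-uniform form bound**:
`φᵀ(cov X σ)φ ≤ (1 + Σ_{i,j}|C_ij|)·Σᵢφᵢ²` whenever `|σ ℓ| ≤ 1` for all pairs `ℓ`. [folklore] -/
theorem quadForm_cov_le (blk : ι → β) (C : Matrix ι ι ℝ) (X : Finset β) (σ : Sym2 β → ℝ)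
    (hσ : ∀ ℓ, |σ ℓ| ≤ 1) (φ : ι → ℝ) :
    φ ⬝ᵥ ((Matrix.of fun i j : ι => (if blk i = blk j then 1 else if blk i ∈ X ∧ blk j ∈ X
        then σ s(blk i, blk j) else 0) * C i j) *ᵥ φ)
      ≤ (1 + ∑ i, ∑ j, |C i j|) * ∑ i, φ i ^ 2 := by
  have hs0 : 0 ≤ ∑ i, φ i ^ 2 := Finset.sum_nonneg fun i _ => sq_nonneg _
  refine (le_abs_self _).trans ((abs_quadForm_le_entries _ φ).trans ?_)
  refine mul_le_mul_of_nonneg_right ?_ hs0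
  have hent : ∀ i j, |(Matrix.of fun i j : ι => (if blk i = blk j then 1 else
      if blk i ∈ X ∧ blk j ∈ X then σ s(blk i, blk j) else 0) * C i j) i j| ≤ |C i j| := by
    intro i j
    rw [Matrix.of_apply, abs_mul]
    refine mul_le_of_le_one_left (abs_nonneg _) ?_
    split_ifs
    · simp
    · exact hσ _
    · simp
  calc ∑ p, ∑ q, |(Matrix.of fun i j : ι => (if blk i = blk j then 1 else
          if blk i ∈ X ∧ blk j ∈ X then σ s(blk i, blk j) else 0) * C i j) p q|
      ≤ ∑ i, ∑ j, |C i j| := Finset.sum_le_sum fun i _ => Finset.sum_le_sum fun j _ => hent i j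
    _ ≤ 1 + ∑ i, ∑ j, |C i j| := le_add_of_nonneg_left zero_le_one

omit [Fintype ι] [DecidableEq ι] in
/-- **Decoupled interpolation points have entries in `[−1, 1]`** (indeed in `[0, 1]`): for a valid
script `s`, `t ∈ [0,1]^β` and any pair of atoms. [folklore] -/
theorem abs_eval_decPt_le_one [Fintype β] {r : β} {k : ℕ} (s : Script r k) (hs : s.Valid)
    {t : β → ℝ} (ht : t ∈ unitCube β) (a b : β) :
    |eval t (Script.decPt ℝ s s(a, b))| ≤ 1 := by
  classical
  rw [mem_unitCube] at ht
  have key : ∀ i j : Fin (k + 1), i ≤ j → |eval t (Script.decPt ℝ s s(s.y i, s.y j))| ≤ 1 := by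
    intro i j hij
    rw [Script.eval_decPt_mk_y s hs hij t]
    have h0 : 0 ≤ ∏ m ∈ Finset.univ.filter (fun m : Fin (k + 1) => i ≤ m ∧ m < j), t (s.y m) :=
      Finset.prod_nonneg fun m _ => (ht (s.y m)).1
    rw [abs_of_nonneg h0]
    exact Finset.prod_le_one (fun m _ => (ht (s.y m)).1) fun m _ => (ht (s.y m)).2
  by_cases ha : a ∈ Finset.univ.image s.y
  · by_cases hb : b ∈ Finset.univ.image s.y
    · obtain ⟨i, -, rfl⟩ := Finset.mem_image.1 ha
      obtain ⟨j, -, rfl⟩ := Finset.mem_image.1 hb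
      rcases le_total i j with hij | hji
      · exact key i j hij
      · rw [Sym2.eq_swap]; exact key j i hji
    · rw [Script.decPt_mk_of_mem_of_notMem (R := ℝ) s ha hb]; simp
  · by_cases hb : b ∈ Finset.univ.image s.y
    · rw [Sym2.eq_swap, Script.decPt_mk_of_mem_of_notMem (R := ℝ) s hb ha]; simp
    · rw [Script.decPt_mk_of_notMem (R := ℝ) s ha hb]; simp

/-! ### §3 GBND's hypothesis for GREP's polynomial-growth class -/

omit [DecidableEq β] in
/-- **`|H| ≤ c·(1+Σφᵢ²)^N ⇒ |E_{Cv}(H)| ≤ c·E_{Cv}[(1+Σφᵢ²)^N]`** (normalised Gaussian expectation,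
`norm_integral_le_of_norm_le`). [folklore] -/
theorem abs_gaussExpect_le_of_abs_le_polyWeight {Cv : Matrix ι ι ℝ} (hCv : Cv.PosDef)
    {H : (ι → ℝ) → ℝ} {c : ℝ} (hc : 0 ≤ c) {N : ℕ}
    (hK : ∀ φ : ι → ℝ, |H φ| ≤ c * (1 + ∑ i, φ i ^ 2) ^ N) :
    |(∫ φ : ι → ℝ, H φ * Real.exp (-(φ ⬝ᵥ (Cv⁻¹ *ᵥ φ)) / 2))
        / ∫ φ : ι → ℝ, Real.exp (-(φ ⬝ᵥ (Cv⁻¹ *ᵥ φ)) / 2)|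
      ≤ c * ((∫ φ : ι → ℝ, (1 + ∑ i, φ i ^ 2) ^ N * Real.exp (-(φ ⬝ᵥ (Cv⁻¹ *ᵥ φ)) / 2))
        / ∫ φ : ι → ℝ, Real.exp (-(φ ⬝ᵥ (Cv⁻¹ *ᵥ φ)) / 2)) := by
  have hPpd : (Cv⁻¹).PosDef := hCv.inv
  have hZ : 0 < ∫ φ : ι → ℝ, Real.exp (-(φ ⬝ᵥ (Cv⁻¹ *ᵥ φ)) / 2) := by
    have hint : Integrable (fun φ : ι → ℝ => (1 : ℝ) * Real.exp (-(φ ⬝ᵥ (Cv⁻¹ *ᵥ φ)) / 2)) :=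
      integrable_polyGrowth_mul_gaussian ι Cv⁻¹ hPpd 0 1 (fun _ => 1)
        measurable_const.aestronglyMeasurable (fun φ => by simp)
    simp only [one_mul] at hint
    exact integral_exp_pos hint
  have hmeas : AEStronglyMeasurable (fun φ : ι → ℝ => c * (1 + ∑ i, φ i ^ 2) ^ N) volume :=
    (continuous_const.mul (Continuous.pow (continuous_const.add (continuous_finsetSum _ fun i _ =>
      (continuous_apply i).pow 2)) N)).aestronglyMeasurable
  have hint : Integrable (fun φ : ι → ℝ =>
      (c * (1 + ∑ i, φ i ^ 2) ^ N) * Real.exp (-(φ ⬝ᵥ (Cv⁻¹ *ᵥ φ)) / 2)) :=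
    integrable_polyGrowth_mul_gaussian ι Cv⁻¹ hPpd N c _ hmeas (fun φ => by
      rw [abs_of_nonneg (by positivity)])
  have hnum : ‖∫ φ : ι → ℝ, H φ * Real.exp (-(φ ⬝ᵥ (Cv⁻¹ *ᵥ φ)) / 2)‖
      ≤ ∫ φ : ι → ℝ, (c * (1 + ∑ i, φ i ^ 2) ^ N) * Real.exp (-(φ ⬝ᵥ (Cv⁻¹ *ᵥ φ)) / 2) := by
    refine norm_integral_le_of_norm_le hint (Filter.Eventually.of_forall fun φ => ?_)
    rw [norm_mul, Real.norm_eq_abs, Real.norm_eq_abs, abs_of_pos (Real.exp_pos _)]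
    exact mul_le_mul_of_nonneg_right (hK φ) (Real.exp_pos _).le
  have hcm : ∫ φ : ι → ℝ, (c * (1 + ∑ i, φ i ^ 2) ^ N) * Real.exp (-(φ ⬝ᵥ (Cv⁻¹ *ᵥ φ)) / 2)
      = c * ∫ φ : ι → ℝ, (1 + ∑ i, φ i ^ 2) ^ N * Real.exp (-(φ ⬝ᵥ (Cv⁻¹ *ᵥ φ)) / 2) := by
    rw [← integral_const_mul]
    exact integral_congr_ae (Filter.Eventually.of_forall fun φ => by ring)
  rw [hcm] at hnum
  rw [abs_div, abs_of_pos hZ, div_le_iff₀ hZ]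
  calc |∫ φ : ι → ℝ, H φ * Real.exp (-(φ ⬝ᵥ (Cv⁻¹ *ᵥ φ)) / 2)|
      ≤ c * ∫ φ : ι → ℝ, (1 + ∑ i, φ i ^ 2) ^ N * Real.exp (-(φ ⬝ᵥ (Cv⁻¹ *ᵥ φ)) / 2) :=
        (Real.norm_eq_abs _).symm.le.trans hnum
    _ = c * ((∫ φ : ι → ℝ, (1 + ∑ i, φ i ^ 2) ^ N * Real.exp (-(φ ⬝ᵥ (Cv⁻¹ *ᵥ φ)) / 2))
          / ∫ φ : ι → ℝ, Real.exp (-(φ ⬝ᵥ (Cv⁻¹ *ᵥ φ)) / 2))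
          * ∫ φ : ι → ℝ, Real.exp (-(φ ⬝ᵥ (Cv⁻¹ *ᵥ φ)) / 2) := by
        rw [mul_assoc, div_mul_cancel₀ _ hZ.ne']

omit [DecidableEq β] in
/-- **Expectation bound for the polynomial-growth class under a form-bounded covariance**:
`|H| ≤ c·(1+Σφᵢ²)^N`, `Cv` positive definite with `φᵀCvφ ≤ ΛΣφᵢ²` ⇒
`|E_{Cv}(H)| ≤ c · N!·(4Λ)^N·e^{1/(4Λ)}·√2^{|ι|}` (✓`GaussMoment.gaussExpect_polyWeight_le`). [folklore] -/
theorem abs_gaussExpect_le_of_polyWeight_formBound {Cv : Matrix ι ι ℝ} (hCv : Cv.PosDef)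
    {Λ : ℝ} (hΛ : 0 < Λ) (hform : ∀ φ : ι → ℝ, φ ⬝ᵥ (Cv *ᵥ φ) ≤ Λ * ∑ i, φ i ^ 2)
    {H : (ι → ℝ) → ℝ} {c : ℝ} (hc : 0 ≤ c) {N : ℕ}
    (hK : ∀ φ : ι → ℝ, |H φ| ≤ c * (1 + ∑ i, φ i ^ 2) ^ N) :
    |(∫ φ : ι → ℝ, H φ * Real.exp (-(φ ⬝ᵥ (Cv⁻¹ *ᵥ φ)) / 2))
        / ∫ φ : ι → ℝ, Real.exp (-(φ ⬝ᵥ (Cv⁻¹ *ᵥ φ)) / 2)|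
      ≤ c * ((N.factorial : ℝ) * (4 * Λ) ^ N * Real.exp (1 / (4 * Λ)) * Real.sqrt 2 ^ Fintype.card ι) :=
  (abs_gaussExpect_le_of_abs_le_polyWeight hCv hc hK).trans
    (mul_le_mul_of_nonneg_left (GaussMoment.gaussExpect_polyWeight_le hCv hΛ hform N) hc)

/-- **GBND's hypothesis for GREP's data in GREP's own polynomial-growth class.** For `C` positive
definite, atom-local smooth factors with tables `‖DⁿG_b(φ)‖ ≤ K_b(n)(1+Σφᵢ²)^{m_b(n)}` (`K ≥ 0`), a
VALID script `s` whose points are the atoms of `X`, and `t ∈ [0,1]^β`: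
`|E(cov X σ_s(t))(D^s Π_{b∈X} G_b)| ≤ [(Π_b K_b(deg b))·N!·(4Λ)^N·e^{1/(4Λ)}·√2^{|ι|}] · Π_{ℓ∈lines(s)} (½Σ_{x,y∈ℓ}|C_xy|)`,
`N = Σ_b m_b(deg b)`, `Λ = 1 + Σ_{i,j}|C_ij|` — GBND's `h` with a constant `M` depending on the
script only through its degree sequence. [folklore] -/
theorem abs_gaussExpect_foldl_dop_prod_le_polyGrowth [Fintype β] (blk : ι → β) (C : Matrix ι ι ℝ)
    (hC : C.PosDef) (X : Finset β) (G : β → (ι → ℝ) → ℝ) (hG : ∀ b, ContDiff ℝ (⊤ : ℕ∞) (G b))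
    (hGl : ∀ (b : β) (φ ψ : ι → ℝ), (∀ i : ι, blk i = b → φ i = ψ i) → G b φ = G b ψ)
    (K : β → ℕ → ℝ) (hK : ∀ b n, 0 ≤ K b n) (m : β → ℕ → ℕ)
    (hKm : ∀ (b : β) (n : ℕ) (φ : ι → ℝ),
      ‖iteratedFDeriv ℝ n (G b) φ‖ ≤ K b n * (1 + ∑ i, φ i ^ 2) ^ m b n)
    {r : β} {k : ℕ} (s : Script r k) (hs : s.Valid) (hsX : Finset.univ.image s.y = X)
    {t : β → ℝ} (ht : t ∈ unitCube β) :
    |(∫ φ : ι → ℝ, (s.lines.foldl (fun (H : (ι → ℝ) → ℝ) (ℓ : Sym2 β) => fun φ : ι → ℝ =>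
          (1 / 2 : ℝ) * ∑ x : ι, ∑ y : ι, if s(blk x, blk y) = ℓ ∧ blk x ≠ blk y then
            C x y * iteratedFDeriv ℝ 2 H φ ![Pi.single x 1, Pi.single y 1] else 0)
          (fun φ : ι → ℝ => ∏ b ∈ X, G b φ)) φ
        * Real.exp (-(φ ⬝ᵥ ((Matrix.of fun i j : ι => (if blk i = blk j then 1 else
          if blk i ∈ X ∧ blk j ∈ X then eval t (Script.decPt ℝ s s(blk i, blk j)) else 0) * C i j)⁻¹
            *ᵥ φ)) / 2))
      / ∫ φ : ι → ℝ, Real.exp (-(φ ⬝ᵥ ((Matrix.of fun i j : ι => (if blk i = blk j then 1 else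
          if blk i ∈ X ∧ blk j ∈ X then eval t (Script.decPt ℝ s s(blk i, blk j)) else 0) * C i j)⁻¹
            *ᵥ φ)) / 2)|
      ≤ ((∏ b ∈ X, K b ((s.lines.map fun ℓ => if b ∈ ℓ then 1 else 0).sum))
          * ((Nat.factorial (∑ b ∈ X, m b ((s.lines.map fun ℓ => if b ∈ ℓ then 1 else 0).sum)) : ℝ)
            * (4 * (1 + ∑ i, ∑ j, |C i j|))
              ^ (∑ b ∈ X, m b ((s.lines.map fun ℓ => if b ∈ ℓ then 1 else 0).sum))
            * Real.exp (1 / (4 * (1 + ∑ i, ∑ j, |C i j|))) * Real.sqrt 2 ^ Fintype.card ι))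
        * (s.lines.map fun ℓ => (1 / 2 : ℝ) * ∑ x : ι, ∑ y : ι,
            if s(blk x, blk y) = ℓ ∧ blk x ≠ blk y then |C x y| else 0).prod := by
  have hL : ∀ ℓ ∈ s.lines, ∀ a ∈ ℓ, a ∈ X :=
    fun ℓ hℓ a ha => hsX ▸ Script.mem_image_of_mem_lines s ℓ hℓ a ha
  have hPy0 : 0 ≤ (s.lines.map fun ℓ => (1 / 2 : ℝ) * ∑ x : ι, ∑ y : ι,
      if s(blk x, blk y) = ℓ ∧ blk x ≠ blk y then |C x y| else 0).prod := by
    refine List.prod_nonneg fun y hy => ?_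
    obtain ⟨ℓ, -, rfl⟩ := List.mem_map.1 hy
    exact mul_nonneg (by norm_num) (Finset.sum_nonneg fun x _ => Finset.sum_nonneg fun y _ => by
      split_ifs
      · exact abs_nonneg _
      · exact le_rfl)
  have hPK0 : 0 ≤ ∏ b ∈ X, K b ((s.lines.map fun ℓ => if b ∈ ℓ then 1 else 0).sum) :=
    Finset.prod_nonneg fun b _ => hK b _
  have hΛ : 0 < 1 + ∑ i, ∑ j, |C i j| :=
    add_pos_of_pos_of_nonneg one_pos (Finset.sum_nonneg fun i _ =>
      Finset.sum_nonneg fun j _ => abs_nonneg _)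
  -- pointwise: `|D^s ΠG (φ)| ≤ (ΠK · Πy) · w^N`
  have hpt : ∀ φ : ι → ℝ, |(s.lines.foldl (fun (H : (ι → ℝ) → ℝ) (ℓ : Sym2 β) => fun φ : ι → ℝ =>
      (1 / 2 : ℝ) * ∑ x : ι, ∑ y : ι, if s(blk x, blk y) = ℓ ∧ blk x ≠ blk y then
        C x y * iteratedFDeriv ℝ 2 H φ ![Pi.single x 1, Pi.single y 1] else 0)
      (fun φ : ι → ℝ => ∏ b ∈ X, G b φ)) φ|
      ≤ ((∏ b ∈ X, K b ((s.lines.map fun ℓ => if b ∈ ℓ then 1 else 0).sum))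
          * (s.lines.map fun ℓ => (1 / 2 : ℝ) * ∑ x : ι, ∑ y : ι,
            if s(blk x, blk y) = ℓ ∧ blk x ≠ blk y then |C x y| else 0).prod)
        * (1 + ∑ i, φ i ^ 2) ^ ∑ b ∈ X, m b ((s.lines.map fun ℓ => if b ∈ ℓ then 1 else 0).sum) := by
    intro φ
    have h := abs_foldl_dop_prod_le_polyGrowth blk C X s.lines hL G hG hGl K m hKm φ
    exact h.trans_eq ((mul_left_comm _ _ _).trans (mul_assoc _ _ _).symm)
  have hσ : ∀ ℓ : Sym2 β, |(fun ℓ : Sym2 β => eval t (Script.decPt ℝ s ℓ)) ℓ| ≤ 1 := by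
    intro ℓ
    induction ℓ using Sym2.ind with
    | h a b => exact abs_eval_decPt_le_one s hs ht a b
  have hform := quadForm_cov_le blk C X (fun ℓ : Sym2 β => eval t (Script.decPt ℝ s ℓ)) hσ
  exact (abs_gaussExpect_le_of_polyWeight_formBound (DecPt.posDef_cov_decPt blk C hC X s hs ht) hΛ
    hform (mul_nonneg hPK0 hPy0) hpt).trans_eq (mul_right_comm _ _ _)

end Summit.QuantumFields.YangMills.Theorems.AnchorGap.ActBound
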